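import Mathlib
import Summits.Ventures.PercRepro.PuncturedLYMCapP34Leaves

/-! # PercRepro — (3,4) value-block table: chain and leaf identities, part 2 (GENERATED, p10 g43). -/

namespace PercRepro.PuncturedLYM.Split.Peel.P34

/-- The leaf identity of the path `[0, 4]` (class `4` of the stage (cap `1`, level `4`)). -/
theorem leaf_0_4 (K f : ℕ) (hK : 4 ≤ K) :
    Rn K f / Rd K f - ((2 : ℚ) * 1 * (b_w2l4_1N K f / b_w2l4_1D K f) / (2 : ℚ)) * 4 = (1 - (b_w1l4_4N K f / b_w1l4_4D K f)) * (f : ℚ) / (1 : ℚ) + ((3 : ℚ) * 1 * 1 / (5 : ℚ)) * ((K : ℚ) - 4) := by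
  rcases Nat.lt_or_ge f 3 with hfT | hfT
  · have hatom1 : atom1 K f ≠ 0 := (atom1_pos_B (by omega)).ne'
    have hatom3 : atom3 K f ≠ 0 := (atom3_pos_B (by omega)).ne'
    linear_combination hl_p0_4 K f hatom1 hatom3 - hr_p0 K f hatom1 - hr_p0_4 K f hatom1 hatom3 + (4 : ℚ) * hg_p0 K f hatom1 hatom3 + (((f : ℚ) / (1 : ℚ)) * 1) * ha_p0_4 K f hatom1 hatom3
  · have hatom1 : atom1 K f ≠ 0 := (atom1_pos_A (by omega) (by omega)).ne'
    have hatom3 : atom3 K f ≠ 0 := (atom3_pos_A (by omega) (by omega)).ne'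
    linear_combination hl_p0_4 K f hatom1 hatom3 - hr_p0 K f hatom1 - hr_p0_4 K f hatom1 hatom3 + (4 : ℚ) * hg_p0 K f hatom1 hatom3 + (((f : ℚ) / (1 : ℚ)) * 1) * ha_p0_4 K f hatom1 hatom3

/-- The leaf identity of the path `[1, 0]` (class `0` of the stage (cap `1`, level `2`)). -/
theorem leaf_1_0 (K f : ℕ) (hK : 1 ≤ K) (hf : 2 ≤ f) :
    Rn K f / Rd K f - (1 / (3 : ℚ)) * 1 = (1 - (b_w2l4_1N K f / b_w2l4_1D K f)) * ((f : ℚ) - 2) / (3 : ℚ) + ((3 : ℚ) * (1 - (b_w2l4_1N K f / b_w2l4_1D K f)) * (b_w1l2_1N K f / b_w1l2_1D K f) / (1 : ℚ)) * ((K : ℚ) - 1) := by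
  rcases Nat.lt_or_ge f 4 with hfT | hfT
  · rcases Nat.lt_or_ge K 4 with hKS | hKS
    · interval_cases K <;> interval_cases f <;> norm_num [Rn, Rd, b_w1l2_1N, b_w2l4_1N, b_w1l2_1D, b_w2l4_1D, atom1, atom3, atom13]
    · have hatom1 : atom1 K f ≠ 0 := (atom1_pos_B (by omega)).ne'
      have hatom3 : atom3 K f ≠ 0 := (atom3_pos_B (by omega)).ne'
      have hatom5 : atom5 K f ≠ 0 := (atom5_pos_B (by omega)).ne'
      have hatom13 : atom13 K f ≠ 0 := (atom13_pos_B (by omega)).ne'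
      linear_combination hl_p1_0 K f hatom1 hatom3 - hr_p1 K f hatom1 + ((K : ℚ) - 1) * hg_p1_0 K f hatom1 hatom3 hatom13 + ((((f : ℚ) - 2) / (3 : ℚ)) * 1 + ((K : ℚ) - 1) * (3 : ℚ) * (b_w1l2_1N K f / b_w1l2_1D K f) * 1) * ha_p1 K f hatom1 hatom3
  · have hatom1 : atom1 K f ≠ 0 := (atom1_pos_A (by omega) (by omega)).ne'
    have hatom3 : atom3 K f ≠ 0 := (atom3_pos_A (by omega) (by omega)).ne'
    have hatom5 : atom5 K f ≠ 0 := (atom5_pos_A (by omega) (by omega)).ne'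
    have hatom13 : atom13 K f ≠ 0 := (atom13_pos_A (by omega) (by omega)).ne'
    linear_combination hl_p1_0 K f hatom1 hatom3 - hr_p1 K f hatom1 + ((K : ℚ) - 1) * hg_p1_0 K f hatom1 hatom3 hatom13 + ((((f : ℚ) - 2) / (3 : ℚ)) * 1 + ((K : ℚ) - 1) * (3 : ℚ) * (b_w1l2_1N K f / b_w1l2_1D K f) * 1) * ha_p1 K f hatom1 hatom3

/-- The leaf identity of the path `[1, 1]` (class `1` of the stage (cap `1`, level `2`)). -/
theorem leaf_1_1 (K f : ℕ) (hK : 2 ≤ K) (hf : 1 ≤ f) :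
    Rn K f / Rd K f - (1 / (3 : ℚ)) * 1 - ((2 : ℚ) * 1 * (b_w2l4_2N K f / b_w2l4_2D K f) / (4 : ℚ)) * 1 = (1 - (b_w2l4_1N K f / b_w2l4_1D K f)) * (1 - (b_w1l2_1N K f / b_w1l2_1D K f)) * ((f : ℚ) - 1) / (2 : ℚ) + ((3 : ℚ) * (1 - (b_w2l4_1N K f / b_w2l4_1D K f)) * (b_w1l2_2N K f / b_w1l2_2D K f) / (2 : ℚ)) * ((K : ℚ) - 2) := by
  rcases Nat.lt_or_ge f 4 with hfT | hfT
  · rcases Nat.lt_or_ge K 4 with hKS | hKS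
    · interval_cases K <;> interval_cases f <;> norm_num [Rn, Rd, b_w1l2_1N, b_w1l2_2N, b_w2l4_1N, b_w2l4_2N, b_w1l2_1D, b_w1l2_2D, b_w2l4_1D, b_w2l4_2D, atom1, atom3, atom5, atom13]
    · have hatom1 : atom1 K f ≠ 0 := (atom1_pos_B (by omega)).ne'
      have hatom3 : atom3 K f ≠ 0 := (atom3_pos_B (by omega)).ne'
      have hatom5 : atom5 K f ≠ 0 := (atom5_pos_B (by omega)).ne'
      have hatom13 : atom13 K f ≠ 0 := (atom13_pos_B (by omega)).ne'
      linear_combination hl_p1_1 K f hatom1 hatom3 hatom5 - hr_p1 K f hatom1 - hr_p1_1 K f hatom1 hatom5 + (1 : ℚ) * hg_p1 K f hatom1 hatom5 + ((K : ℚ) - 2) * hg_p1_1 K f hatom1 hatom3 hatom5 hatom13 + ((((f : ℚ) - 1) / (2 : ℚ)) * (1 - (b_w1l2_1N K f / b_w1l2_1D K f)) + ((K : ℚ) - 2) * ((3 : ℚ) / 2) * (b_w1l2_2N K f / b_w1l2_2D K f) * 1) * ha_p1 K f hatom1 hatom3 + ((((f : ℚ) - 1) / (2 : ℚ)) * 1)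 * ha_p1_1 K f hatom1 hatom3 hatom13
  · have hatom1 : atom1 K f ≠ 0 := (atom1_pos_A (by omega) (by omega)).ne'
    have hatom3 : atom3 K f ≠ 0 := (atom3_pos_A (by omega) (by omega)).ne'
    have hatom5 : atom5 K f ≠ 0 := (atom5_pos_A (by omega) (by omega)).ne'
    have hatom13 : atom13 K f ≠ 0 := (atom13_pos_A (by omega) (by omega)).ne'
    linear_combination hl_p1_1 K f hatom1 hatom3 hatom5 - hr_p1 K f hatom1 - hr_p1_1 K f hatom1 hatom5 + (1 : ℚ) * hg_p1 K f hatom1 hatom5 + ((K : ℚ) - 2) * hg_p1_1 K f hatom1 hatom3 hatom5 hatom13 + ((((f : ℚ) - 1) / (2 : ℚ)) * (1 - (b_w1l2_1N K f / b_w1l2_1D K f)) + ((K : ℚ) - 2) * ((3 : ℚ) / 2) * (b_w1l2_2N K f / b_w1l2_2D K f) * 1) * ha_p1 K f hatom1 hatom3 + ((((f : ℚ) - 1) / (2 : ℚ)) * 1) * ha_p1_1 K f hatom1 hatom3 hatom13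

/-- The leaf identity of the path `[1, 2]` (class `2` of the stage (cap `1`, level `2`)). -/
theorem leaf_1_2 (K f : ℕ) (hK : 3 ≤ K) :
    Rn K f / Rd K f - (1 / (3 : ℚ)) * 1 - ((2 : ℚ) * 1 * (b_w2l4_2N K f / b_w2l4_2D K f) / (4 : ℚ)) * 2 = (1 - (b_w2l4_1N K f / b_w2l4_1D K f)) * (1 - (b_w1l2_2N K f / b_w1l2_2D K f)) * (f : ℚ) / (1 : ℚ) + ((3 : ℚ) * (1 - (b_w2l4_1N K f / b_w2l4_1D K f)) * 1 / (3 : ℚ)) * ((K : ℚ) - 3) := by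
  rcases Nat.lt_or_ge f 4 with hfT | hfT
  · rcases Nat.lt_or_ge K 4 with hKS | hKS
    · interval_cases K; interval_cases f <;> norm_num [Rn, Rd, b_w1l2_2N, b_w2l4_1N, b_w2l4_2N, b_w1l2_2D, b_w2l4_1D, b_w2l4_2D, atom1, atom3, atom5, atom13]
    · have hatom1 : atom1 K f ≠ 0 := (atom1_pos_B (by omega)).ne'
      have hatom3 : atom3 K f ≠ 0 := (atom3_pos_B (by omega)).ne'
      have hatom5 : atom5 K f ≠ 0 := (atom5_pos_B (by omega)).ne'
      have hatom13 : atom13 K f ≠ 0 := (atom13_pos_B (by omega)).ne'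
      linear_combination hl_p1_2 K f hatom1 hatom3 hatom5 - hr_p1 K f hatom1 - hr_p1_2 K f hatom1 hatom5 + (2 : ℚ) * hg_p1 K f hatom1 hatom5 + ((K : ℚ) - 3) * hg_p1_2 K f hatom1 hatom3 + (((f : ℚ) / (1 : ℚ)) * (1 - (b_w1l2_2N K f / b_w1l2_2D K f)) + ((K : ℚ) - 3) * (1 : ℚ) * 1 * 1) * ha_p1 K f hatom1 hatom3 + (((f : ℚ) / (1 : ℚ)) * 1) * ha_p1_2 K f hatom1 hatom3 hatom5 hatom13
  · have hatom1 : atom1 K f ≠ 0 := (atom1_pos_A (by omega) (by omega)).ne'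
    have hatom3 : atom3 K f ≠ 0 := (atom3_pos_A (by omega) (by omega)).ne'
    have hatom5 : atom5 K f ≠ 0 := (atom5_pos_A (by omega) (by omega)).ne'
    have hatom13 : atom13 K f ≠ 0 := (atom13_pos_A (by omega) (by omega)).ne'
    linear_combination hl_p1_2 K f hatom1 hatom3 hatom5 - hr_p1 K f hatom1 - hr_p1_2 K f hatom1 hatom5 + (2 : ℚ) * hg_p1 K f hatom1 hatom5 + ((K : ℚ) - 3) * hg_p1_2 K f hatom1 hatom3 + (((f : ℚ) / (1 : ℚ)) * (1 - (b_w1l2_2N K f / b_w1l2_2D K f)) + ((K : ℚ) - 3) * (1 : ℚ) * 1 * 1) * ha_p1 K f hatom1 hatom3 + (((f : ℚ) / (1 : ℚ)) * 1) * ha_p1_2 K f hatom1 hatom3 hatom5 hatom13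

/-- The leaf identity of the path `[2, 0]` (class `0` of the stage (cap `1`, level `0`)). -/
theorem leaf_2_0 (K f : ℕ) (hK : 2 ≤ K) :
    Rn K f / Rd K f - (1 / (3 : ℚ)) * 2 = (1 - (b_w2l4_2N K f / b_w2l4_2D K f)) * (f : ℚ) / (1 : ℚ) + ((3 : ℚ) * (1 - (b_w2l4_2N K f / b_w2l4_2D K f)) * 1 / (1 : ℚ)) * ((K : ℚ) - 2) := by
  rcases Nat.lt_or_ge f 4 with hfT | hfT
  · rcases Nat.lt_or_ge K 3 with hKS | hKS
    · interval_cases K; interval_cases f <;> norm_num [Rn, Rd, b_w2l4_2N, b_w2l4_2D, atom1, atom5]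
    · have hatom1 : atom1 K f ≠ 0 := (atom1_pos_B (by omega)).ne'
      have hatom5 : atom5 K f ≠ 0 := (atom5_pos_B (by omega)).ne'
      linear_combination hl_p2_0 K f hatom1 hatom5 - hr_p2 K f hatom1 + ((K : ℚ) - 2) * hg_p2_0 K f hatom1 hatom5 + (((f : ℚ) / (1 : ℚ)) * 1 + ((K : ℚ) - 2) * (3 : ℚ) * 1 * 1) * ha_p2 K f hatom1 hatom5
  · have hatom1 : atom1 K f ≠ 0 := (atom1_pos_A (by omega) (by omega)).ne'
    have hatom5 : atom5 K f ≠ 0 := (atom5_pos_A (by omega) (by omega)).ne'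
    linear_combination hl_p2_0 K f hatom1 hatom5 - hr_p2 K f hatom1 + ((K : ℚ) - 2) * hg_p2_0 K f hatom1 hatom5 + (((f : ℚ) / (1 : ℚ)) * 1 + ((K : ℚ) - 2) * (3 : ℚ) * 1 * 1) * ha_p2 K f hatom1 hatom5

/-- The free-point leaf at `K = 0`: `R = (f − 4)/5`. -/
theorem leaf_zero_strip (K f : ℕ) (hK : K = 0) (hf : 4 ≤ f) :
    Rn K f / Rd K f = (f - 4) / (5 : ℚ) := by
  subst hK
  have h0 : atom1 0 f ≠ 0 := (atom1_pos_zero (by omega)).ne'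
  have hRd : Rd 0 f ≠ 0 := by simp only [Rd]; exact (mul_ne_zero (by norm_num) h0)
  push_cast
  field_simp
  simp only [Rn, Rd, atom1]; ring

end PercRepro.PuncturedLYM.Split.Peel.P34
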